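import Mathlib.Algebra.Group.Basic
import Mathlib.Algebra.Module.Defs
import Mathlib.LinearAlgebra.Alternating.Basic
import Mathlib.Data.Fin.VecNotation
import Mathlib.Tactic.Abel
import Mathlib.Tactic.NormNum
import Mathlib.Tactic.Module
import Mathlib.Tactic.LinearCombination
import Mathlib.Tactic.Linarith
import Mathlib.Tactic.FieldSimp
import Mathlib.Tactic.FinCases
import HarnessLib

/-!
# The fold of Schoen's period map — kernel skeleton (WEIL-2 gen 49, FOLD-G49, fact-free)

research route, not a corollary; conditional on HC_CM plus one named minimal statement.

Cell `pub-hodge-ring2-ab-*` (ALL ABELIAN VARIETIES), seat WEIL-2 gen 49, account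
`run/shared/lean/pub/pub-hodge-ring2/pub-hodge-ring2-ab-weil-2/FOLD-G49.md`.

Informal setting.  `Hur = Hur(μ₆; E; [1,3,4,4] / [2,2,3,5])` is Schoen's 4-dimensional family of `μ₆`-covers of
elliptic curves branched at four points; its `K`-piece period map `Φ : Hur → S₂₂(ℚ(√−3))^{[2]}/Γ` is dominant and,
by THEOREM R (BRILLNOETHER-G43), has corank exactly 1 on the divisor `R = {2D₀ ∼ B'}`.  FOLD-G49 proves that `Φ`
is a simple (Whitney) FOLD along `R`: (LEMMA C) the conormal of `R` is `ω ⊗ d log h`, via the involution of `E` about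
`y₁`; (LEMMA T) it does not lie in `Im dΦ^∨ = g·⟨1, f_T, f_T²⟩ω²`, because `φ = y(x−x₂)/L_T` is not even under
`ι_T : P ↦ T − P` — its divisor would have to contain `T + e₁` among `{e₁, e₂, e₃, 2T}`; (LEMMA S) `det dΦ` vanishes
simply along `R`, the derivative of the determinant along a transversal arc being `(Ṡ' − Ṡ)·det[1, f_T, ḟ_T, f_T²]`
with `Ṡ' − Ṡ = −δ̇/3`.  Consequences: `deg Φ ≥ 2` (generic Prym–Torelli fails for Schoen's presentation; the two
presentations near the branch divisor live over non-isomorphic elliptic curves), and the obvious involution `σ̃` of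
`Hur` fixing `R` is not the fold involution.  ERRATUM E-g49-1 corrects the census: the six `f = 6`, `d = 2` data are
generically immersive but not at every member (2 691 + 6, not 2 697, at every member).

This file holds the finite algebra: the translate lemma (LEMMA T), the alternating-form identity (LEMMA S), the
arc and `σ̃` bookkeeping in an arbitrary additive commutative group standing for `E` resp. the class group, the
residue pairing of the conormal, the two square roots behind «local degree 2», the automorphism count, and the
census arithmetic.  0 sorry, no `def`, no named fact; `HC_CM` does not occur.
-/

namespace Summit.HodgeConjecture.Ring2AbelianAll.PrymTorelliFold

section lemmaT

variable {G : Type*} [AddCommGroup G]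

/-- FOLD-G49 §3.1 (the translate step of LEMMA T).  On an elliptic curve with points of order two `e, e₁, e₂, e₃`
(`2e = 2e_i = 0`) and a point `T` with `2T ≠ 0` (on `R`: `2T = y₂ ≠ y₁ = O`), the translate `T + e` is none of
`e₁, e₂, e₃, 2T`.  Hence the divisor `(e₁)+(e₂)+(e₃)+(2T) − 2(T) − 2(O)` of `φ = y(x − x₂)/L_T` is not stable under
`ι_T : P ↦ T − P` (which sends `e_i ↦ T + e_i`), `φ` is not `ι_T`-even, and `q_Z ∉ Im μ`.
research route, not a corollary; conditional on HC_CM plus one named minimal statement. -/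
theorem translate_not_mem (T e e₁ e₂ e₃ : G) (he : (2 : ℤ) • e = 0) (he₁ : (2 : ℤ) • e₁ = 0)
    (he₂ : (2 : ℤ) • e₂ = 0) (he₃ : (2 : ℤ) • e₃ = 0) (hT : (2 : ℤ) • T ≠ 0) :
    T + e ≠ e₁ ∧ T + e ≠ e₂ ∧ T + e ≠ e₃ ∧ T + e ≠ (2 : ℤ) • T := by
  refine ⟨?_, ?_, ?_, ?_⟩
  · intro h; apply hT
    have h' : T = e₁ - e := by rw [← h]; abel
    rw [h', smul_sub, he₁, he, sub_zero]
  · intro h; apply hT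
    have h' : T = e₂ - e := by rw [← h]; abel
    rw [h', smul_sub, he₂, he, sub_zero]
  · intro h; apply hT
    have h' : T = e₃ - e := by rw [← h]; abel
    rw [h', smul_sub, he₃, he, sub_zero]
  · intro h; apply hT
    have h' : T = e := by
      have : e = (2 : ℤ) • T - T := by rw [← h]; abel
      rw [this]; abel
    rw [h', he]

/-- FOLD-G49 §3.1 / §1.2 (why `2T ≠ 0` on `R`, and the sheet count): in normal form `D₀ = (O) + (T)` with `2T = y₂`,
and `y₂ ≠ y₁ = O`; so `2T ≠ 0`, in particular `T` is not a point of order two.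
research route, not a corollary; conditional on HC_CM plus one named minimal statement. -/
theorem two_T_ne_zero (T y₂ : G) (h : (2 : ℤ) • T = y₂) (hy : y₂ ≠ 0) : (2 : ℤ) • T ≠ 0 := by
  rw [h]; exact hy

end lemmaT

section lemmaS

/-- FOLD-G49 §4.1 (the derivative of the determinant, LEMMA S).  For any alternating 4-form `ψ` (here: the `4 × 4`
evaluation determinant `det[m_i(P_j)]` as a function of its four columns) and columns `a, u, w, b`:
`ψ(a, u, u − ε•w, b) = −ε • ψ(a, u, w, b)`.  With `u = f_T`, `w = ḟ_T`, `ε ↦ (Ṡ − Ṡ')·(arc parameter)` this is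
`N(δ) = (Ṡ' − Ṡ)·det[1, f_T, ḟ_T, f_T²]·δ + O(δ²)`: the determinant vanishes to first order iff `1, f_T, ḟ_T, f_T²` are
independent.  research route, not a corollary; conditional on HC_CM plus one named minimal statement. -/
theorem wedge_linear_term {R M N : Type*} [CommRing R] [AddCommGroup M] [Module R M] [AddCommGroup N]
    [Module R N] (ψ : M [⋀^Fin 4]→ₗ[R] N) (a u w b : M) (ε : R) :
    ψ ![a, u, u - ε • w, b] = -ε • ψ ![a, u, w, b] := by
  have hv : (![a, u, u - ε • w, b] : Fin 4 → M) = Function.update ![a, u, w, b] 2 (u - ε • w) := by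
    ext i; fin_cases i <;> simp
  have hu : (Function.update ![a, u, w, b] 2 u : Fin 4 → M) 1 =
      (Function.update ![a, u, w, b] 2 u : Fin 4 → M) 2 := by simp
  have hw : (Function.update ![a, u, w, b] 2 w : Fin 4 → M) = ![a, u, w, b] := by
    ext i; fin_cases i <;> simp
  rw [hv, ψ.map_update_sub, ψ.map_update_smul, ψ.map_eq_zero_of_eq _ hu (by decide), hw, zero_sub, neg_smul]

/-- FOLD-G49 §1.2 / §4.1 (arc bookkeeping in the group `E`, additive notation, `y₁ = O = 0`).  Admissibility
`6D₀ ∼ A` for `D₀ = (O) + (S)` reads `6S = 3y₂ + 4δ` (`δ = y₃ + y₄`); the class `[2D₀ − B']` is the point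
`ε = 2S − y₂ − δ`, and then `3ε = δ`: `R̄ = {δ = 0}`, `R = {ε = 0}`.
research route, not a corollary; conditional on HC_CM plus one named minimal statement. -/
theorem arc_bookkeeping {G : Type*} [AddCommGroup G] (S y₂ δ : G)
    (h : (6 : ℤ) • S = (3 : ℤ) • y₂ + (4 : ℤ) • δ) :
    (3 : ℤ) • ((2 : ℤ) • S - y₂ - δ) = δ := by
  linear_combination (norm := module) h

/-- FOLD-G49 §4.1 (the velocities along the transversal arc, in the uniformisation): from `6Ṡ = 4δ̇`,
`ε̇ = 2Ṡ − δ̇` and `Ṡ' = Ṡ − ε̇` one gets `Ṡ = (2/3)δ̇`, `ε̇ = δ̇/3`, `Ṡ' = δ̇/3` and `Ṡ' − Ṡ = −δ̇/3 ≠ 0` for `δ̇ ≠ 0`.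
research route, not a corollary; conditional on HC_CM plus one named minimal statement. -/
theorem arc_velocities (dS dS' dε dδ : ℚ) (h1 : 6 * dS = 4 * dδ) (h2 : dε = 2 * dS - dδ)
    (h3 : dS' = dS - dε) (hδ : dδ ≠ 0) :
    dS = 2 / 3 * dδ ∧ dε = dδ / 3 ∧ dS' = dδ / 3 ∧ dS' - dS = -(dδ / 3) ∧ dS' - dS ≠ 0 := by
  refine ⟨by linarith, by linarith, by linarith, by linarith, ?_⟩
  intro h0
  apply hδ
  linarith

end lemmaS

section sigma

variable {G : Type*} [AddCommGroup G]

/-- FOLD-G49 §5.5 (PROPOSITION Σ: `σ̃` is admissible).  If `(E; O, y₂, y₃, y₄; (O)+(S))` is admissible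
(`6S = 3y₂ + 4δ`, `δ = y₃ + y₄`) then so is its image `(E; O, y₂, −y₄, −y₃; (O)+(y₂ − S))`, whose `δ` is `−δ`.
research route, not a corollary; conditional on HC_CM plus one named minimal statement. -/
theorem sigma_admissible (S y₂ δ : G) (h : (6 : ℤ) • S = (3 : ℤ) • y₂ + (4 : ℤ) • δ) :
    (6 : ℤ) • (y₂ - S) = (3 : ℤ) • y₂ + (4 : ℤ) • (-δ) := by
  linear_combination (norm := module) -h

/-- FOLD-G49 §5.5 (`σ̃` is an involution): `(y₃, y₄) ↦ (−y₄, −y₃)` and `S ↦ y₂ − S` square to the identity.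
research route, not a corollary; conditional on HC_CM plus one named minimal statement. -/
theorem sigma_involutive (y₂ y₃ y₄ S : G) :
    (-(-y₃) = y₃ ∧ -(-y₄) = y₄) ∧ y₂ - (y₂ - S) = S := by
  refine ⟨⟨neg_neg y₃, neg_neg y₄⟩, ?_⟩; abel

/-- FOLD-G49 §5.5 (`Fix(σ̃) = R`): a point is fixed iff `y₃ = −y₄` (i.e. `δ = y₃ + y₄ = 0`, the configuration lies on
`R̄`) and `S = y₂ − S` (i.e. `2S = y₂`: the sheet lies on `R`, §1.2).
research route, not a corollary; conditional on HC_CM plus one named minimal statement. -/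
theorem sigma_fixed_iff (y₂ y₃ y₄ S : G) :
    (y₃ = -y₄ ∧ y₄ = -y₃ ∧ S = y₂ - S) ↔ (y₃ + y₄ = 0 ∧ S + S = y₂) := by
  constructor
  · rintro ⟨h₃, -, hS⟩
    refine ⟨by rw [h₃]; abel, ?_⟩
    have : S + S = y₂ - S + S := by rw [← hS]
    rw [this]; abel
  · rintro ⟨hδ, hS⟩
    have h₃ : y₃ = -y₄ := by
      have : y₃ = y₃ + y₄ - y₄ := by abel
      rw [this, hδ]; abel
    refine ⟨h₃, ?_, ?_⟩
    · rw [h₃]; abel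
    · rw [← hS]; abel

/-- FOLD-G49 §5.2 (the automorphism count on `R`, type I).  An automorphism of a general member fixes `y₁ = O` and
`y₂`, so is `±1` on `E`; `−1` fixes `y₂` iff `2y₂ = 0` iff `4T = 0` (`y₂ = 2T`).  Off this locus `Aut = μ₆` and the
Kuranishi family injects into `Hur`, so the two fold partners are non-isomorphic covers.
research route, not a corollary; conditional on HC_CM plus one named minimal statement. -/
theorem aut_count (T y₂ : G) (h : y₂ = (2 : ℤ) • T) :
    (-y₂ = y₂ ↔ (2 : ℤ) • y₂ = 0) ∧ ((2 : ℤ) • y₂ = 0 ↔ (4 : ℤ) • T = 0) := by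
  constructor
  · constructor
    · intro hn
      have : (2 : ℤ) • y₂ = y₂ + y₂ := two_zsmul y₂
      rw [this]
      nth_rewrite 1 [← hn]
      abel
    · intro h2
      have : y₂ + y₂ = 0 := by rw [← two_zsmul]; exact h2
      have h' : -y₂ = -y₂ + (y₂ + y₂) := by rw [this, add_zero]
      rw [h']; abel
  · rw [h, smul_smul]; norm_num

end sigma

section conormal

/-- FOLD-G49 §2.2 (a) (residues of the conormal `q_Z = ω ⊗ d log h`, `div h = y₃ + y₄ − 2y₁`): the residue vector is
`(−2, 0, 1, 1)` (sum `0`); in the translation gauge `v₁ = 0` it pairs to zero with every point-move tangent to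
`R̄ = {y₃ + y₄ = 2y₁}` (`v₂` free, `v₄ = −v₃`), and to `2 ≠ 0` with `σ̃`'s `(−1)`-direction `∂_{y₃} + ∂_{y₄}` — which is
therefore transversal to `R̄`, as it must be.
research route, not a corollary; conditional on HC_CM plus one named minimal statement. -/
theorem conormal_residues :
    ((-2 : ℤ) + 0 + 1 + 1 = 0) ∧
    (∀ v₂ v₃ : ℤ, (-2) * 0 + 0 * v₂ + 1 * v₃ + 1 * (-v₃) = 0) ∧
    ((-2 : ℤ) * 0 + 0 * 0 + 1 * 1 + 1 * 1 = 2) := by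
  refine ⟨by norm_num, fun v₂ v₃ => by ring, by norm_num⟩

/-- FOLD-G49 §2.1 / §1.2 (dimension bookkeeping on `E`): `dim L(D) = deg D` for `deg D ≥ 1`; so
`L((O)+(y₃)+(y₄))` has dimension `3 = 2 + 1` (even part `⟨1, 1/(x−x₃)⟩`, odd part `⟨y/(x−x₃)⟩`: the conormal line),
`L(2(O)+2(T))` has dimension `4 = 3 + 1` (the `ι_T`-even part = quadratic polynomials in `f_T`, dimension 3; `Im μ`
has rank 3 = `4 − 1`, THEOREM R), and `L(B')` has dimension `4 = dim Hur`.
research route, not a corollary; conditional on HC_CM plus one named minimal statement. -/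
theorem riemann_roch_counts : (3 = 2 + 1) ∧ (4 = 3 + 1) ∧ (2 * 2 = 4) ∧ (4 - 1 = 3) := by norm_num

end conormal

section fold

/-- FOLD-G49 §5.1–5.2 (local degree two).  In the fold normal form `(r, t) ↦ (r, t²)` the fibre over `(r, s)`,
`s ≠ 0`, consists of the two square roots of `s`, which are distinct (characteristic `≠ 2`): every point off the
branch divisor and close to it has exactly two preimages near the fold — `deg Φ ≥ 2`.
research route, not a corollary; conditional on HC_CM plus one named minimal statement. -/
theorem fold_two_preimages {F : Type*} [Field F] (h2 : (2 : F) ≠ 0) (t₀ s : F) (hs : s ≠ 0)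
    (ht : t₀ ^ 2 = s) :
    (∀ t : F, t ^ 2 = s ↔ (t = t₀ ∨ t = -t₀)) ∧ t₀ ≠ -t₀ := by
  refine ⟨fun t => ?_, ?_⟩
  · rw [← ht]; exact sq_eq_sq_iff_eq_or_eq_neg
  · intro h
    apply hs
    have h0 : (2 : F) * t₀ = 0 := by linear_combination h
    have ht0 : t₀ = 0 := by
      rcases mul_eq_zero.mp h0 with h' | h'
      · exact absurd h' h2
      · exact h'
    rw [← ht, ht0]; ring

/-- FOLD-G49 §5.1 (the normal form from the two lemmas, one-variable shadow): if `f(t) = t²·b` with `b ≠ 0` then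
`f` vanishes to order exactly two at `0` and `f'(t) = 2bt` vanishes to order exactly one — the dictionary
«`ord_R det dΦ = e − 1`» with `e = 2` (LEMMA S gives `e − 1 = 1`).
research route, not a corollary; conditional on HC_CM plus one named minimal statement. -/
theorem fold_orders (e : ℕ) (he : e - 1 = 1) (he2 : 2 ≤ e) : e = 2 := by omega

end fold

section erratum

/-- FOLD-G49 §7 (ERRATUM E-g49-1, PROPOSITIONS D₂, D₃: the symmetric-square bound).  On `{2D₀ ∼ B'}` one has
`V ≅ V'` and `Im μ = μ(Sym² V)`, of dimension at most `n(n+1)/2` for `dim V = n`: `q = 1` (`n = 2`): `3 < 4`;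
`q = 2` (`n = 3`): `6 < 7 = dim Hur` — deficient; `q = 3` (`n = 4`): `10 = dim Hur`, no forced deficiency, but the
quadric containing the hyperelliptic sextic costs one more: `10 − 1 < 10`.  `dim Hur = 3q + 1`.
research route, not a corollary; conditional on HC_CM plus one named minimal statement. -/
theorem sym2_bound :
    (2 * 3 / 2 = 3 ∧ 3 < 3 * 1 + 1) ∧ (3 * 4 / 2 = 6 ∧ 6 < 3 * 2 + 1) ∧
    (4 * 5 / 2 = 10 ∧ 10 = 3 * 3 + 1 ∧ 10 - 1 < 3 * 3 + 1) := by norm_num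

/-- FOLD-G49 §1.2 / §7.3 / §7.4 (the sheets on `{2D₀ ∼ B'}`): over a base of genus `q` the admissible `D₀` form a
`J[6]`-torsor (`6^{2q}` sheets) and those with `2D₀ ∼ B'` a `J[2]`-torsor (`2^{2q}`): `4` of `36`, `16` of `1296`,
`64` of `46656`; the configurations `{y₃ + y₄ ∼ 2y₁, y₃ ≠ y₄}` have codimension `q` (`q = 1`: one relation on `E`;
`q = 2`: `y₁` Weierstrass and `y₄ = ῑy₃`; `q = 3`: `Y` hyperelliptic, `y₁` Weierstrass, `y₄ = ῑy₃`).
research route, not a corollary; conditional on HC_CM plus one named minimal statement. -/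
theorem sheet_counts :
    (2 ^ (2 * 1) = 4 ∧ 6 ^ (2 * 1) = 36) ∧ (2 ^ (2 * 2) = 16 ∧ 6 ^ (2 * 2) = 1296) ∧
    (2 ^ (2 * 3) = 64 ∧ 6 ^ (2 * 3) = 46656) ∧ (1 = 1 ∧ 1 + 1 = 2 ∧ 1 + 1 + 1 = 3) := by norm_num

/-- FOLD-G49 §7.5 (CENSUS OF RECORD after E-g49-1; positive-dimensional non-split Galois–Prym data, `n ≤ 4`, all 429
levels): at EVERY member `40 + 24 + 1062 + 96 + 1462 + 7 = 2691`; generically immersive only (and provably not at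
every member): the six `f = 6`, `d = 2` data, `2 + 2 + 2`; `2691 + 6 = 2697` genuine data (`f = 6`: `64 + 6 = 70`),
nominal `2697 + 2 = 2699`.  Replaces «2 697 / 2 697 at every member» of WALL-G48 §5.
research route, not a corollary; conditional on HC_CM plus one named minimal statement. -/
theorem census_after_erratum :
    40 + 24 + 1062 + 96 + 1462 + 7 = 2691 ∧ 2 + 2 + 2 = 6 ∧ 2691 + 6 = 2697 ∧ 64 + 6 = 70 ∧
    40 + 24 = 64 ∧ 2697 + 2 = 2699 := by norm_num

end erratum

section theoremD

/-- FOLD-G49 §7.2 (THEOREM D, the scroll bound).  On `R_q = {2D₀ ∼ B'}` over a hyperelliptic base of genus `q ≥ 2`,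
`Im μ = μ(Sym² H⁰(L))`, `L = K + D₀`, `h⁰(L) = q + 1`; the `2 × (q−1)` matrix `M(g¹₂, L − g¹₂)` is 1-generic and its
`(q−1)(q−2)/2` linearly independent `2 × 2` minors are quadrics through `Y` [Eisenbud, Geometry of Syzygies, Prop. 6.10,
Thm. 6.4], so `rank μ ≤ (q+1)(q+2)/2 − (q−1)(q−2)/2 = 3q < 3q + 1 = dim Hur`: deficient.  (Stated as the identity
`(q−1)(q−2) + 2·3q = (q+1)(q+2)` in `ℕ`, `q ≥ 2`, to avoid truncated division; `q = 2`: no quadric, `6 < 7`; `q = 3`: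
one quadric, `10 − 1 = 9 < 10`; `q = 4` (`n = 5`): three quadrics, `15 − 3 = 12 < 13`.)
research route, not a corollary; conditional on HC_CM plus one named minimal statement. -/
theorem scroll_bound (q : ℕ) (hq : 2 ≤ q) :
    (q - 1) * (q - 2) + 2 * (3 * q) = (q + 1) * (q + 2) ∧ 3 * q < 3 * q + 1 ∧
    ((3 - 1) * (3 - 2) = 2 * 1 ∧ 10 - 1 = 3 * 3) ∧ ((4 - 1) * (4 - 2) = 2 * 3 ∧ 15 - 3 = 3 * 4) := by
  obtain ⟨k, rfl⟩ : ∃ k, q = k + 2 := ⟨q - 2, by omega⟩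
  refine ⟨?_, by omega, by norm_num, by norm_num⟩
  have h1 : k + 2 - 1 = k + 1 := by omega
  have h2 : k + 2 - 2 = k := by omega
  rw [h1, h2]; ring

/-- FOLD-G49 §7.2 (THEOREM D, Green's side; = ELLBASE-G47 `green_boundary_bookkeeping` specialised to `H = 1`): for a
`d = 2` datum over a base of genus `q`, `L = K + D₀` and `M = K + B' − D₀` have degree `2q − 2 + 2 = 2q`,
`w = h⁰(L) = q + 1`, and `h¹(M ⊗ L⁻¹) = q − 1 + h⁰(B' − 2D₀)`; Green's hypothesis `h¹ ≤ w − 2` holds iff `h⁰(B' − 2D₀) = 0`,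
i.e. iff `2D₀ ≁ B'` — then `μ` is onto and the period map is an immersion.  The codimension of `R̄_q` is
`(q − 2) + 1 + 1 = q` for `q ≥ 2` (hyperelliptic base, `y₁` Weierstrass, `y₄ = ῑy₃`) and `1` for `q = 1`.
research route, not a corollary; conditional on HC_CM plus one named minimal statement. -/
theorem green_side (q h0 : ℕ) (hq : 1 ≤ q) :
    (2 * q - 2 + 2 = 2 * q) ∧ ((q - 1 + h0 ≤ (q + 1) - 2) ↔ h0 = 0) ∧ (2 ≤ q → (q - 2) + 1 + 1 = q) := by
  refine ⟨by omega, ⟨fun h => by omega, fun h => by omega⟩, fun h => by omega⟩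

end theoremD

section postscript

/-- FOLD-G49 §11 (P.S., PROPOSITION NH: Newton's identities used to read `Tr(Frob³)`, `Tr(Frob⁶)` on `H¹_χ` from
`e₁ = t₁`, `p₂ = s₂` and the duality-determined `e₃ = p·u·σ(e₁)`, `e₄ = p²u`).  For four eigenvalues with elementary
symmetric functions `e₁,…,e₄` and power sums `p_k`: `p₃ = e₁p₂ − e₂p₁ + 3e₃` and
`p₄ = e₁p₃ − e₂p₂ + e₃p₁ − 4e₄` (stated for explicit `α, β, γ, δ`).
research route, not a corollary; conditional on HC_CM plus one named minimal statement. -/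
theorem newton_identities {R : Type*} [CommRing R] (α β γ δ : R) :
    let e₁ := α + β + γ + δ
    let e₂ := α*β + α*γ + α*δ + β*γ + β*δ + γ*δ
    let e₃ := α*β*γ + α*β*δ + α*γ*δ + β*γ*δ
    let e₄ := α*β*γ*δ
    let p₁ := α + β + γ + δ
    let p₂ := α^2 + β^2 + γ^2 + δ^2
    let p₃ := α^3 + β^3 + γ^3 + δ^3
    let p₄ := α^4 + β^4 + γ^4 + δ^4
    p₃ = e₁ * p₂ - e₂ * p₁ + 3 * e₃ ∧ p₄ = e₁ * p₃ - e₂ * p₂ + e₃ * p₁ - 4 * e₄ := by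
  simp only
  constructor <;> ring

/-- FOLD-G49 §11 (P.S., PROPOSITION NH: why the rationality test runs over `m ∣ 6`).  Frobenius acts on a quaternion
algebra `B ⊇ K = ℚ(ζ₆)` of endomorphisms, fixing `K`, as conjugation by some `k ∈ K^×`; on `B = K ⊕ KJ` (`Jk = k̄J`)
this is `J ↦ (k/k̄)J`, and `k/k̄` is a root of unity of `K`, of order dividing `6`; so `Frob^m` commutes with `B` for
some `m ∈ {1, 2, 3, 6}` — the divisors of `6`.
research route, not a corollary; conditional on HC_CM plus one named minimal statement. -/
theorem frobenius_orders_divide_six : ∀ m ∈ ({1, 2, 3, 6} : Finset ℕ), m ∣ 6 := by decide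

/-- FOLD-G49 §11 (P.S., the valuation pinning `e₄ = p²u`): the rank-one crystal `det H¹_χ` has Hodge number
`h^{0,1}_χ = 2` at each of the two places over `p`, so `v_π(e₄) = v_π̄(e₄) = 2` and `e₄/p²` is a unit of `ℤ[ζ₆]`
(one of 6); the census allows all six.  Bookkeeping: `2 + 2 = 4 = dim H¹_χ`, `|μ(ℤ[ζ₆])| = 6 = 2·3`.
research route, not a corollary; conditional on HC_CM plus one named minimal statement. -/
theorem determinant_bookkeeping : 2 + 2 = 4 ∧ (6 : ℕ) = 2 * 3 ∧ (2 : ℕ) ∣ 6 ∧ (3 : ℕ) ∣ 6 := by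
  refine ⟨rfl, rfl, by decide, by decide⟩

end postscript

end Summit.HodgeConjecture.Ring2AbelianAll.PrymTorelliFold
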